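import Summits.Ventures.LatticeQCDFlow.Scoring.NonabelianAreaLaw2DPeeling
import Summits.Ventures.LatticeQCDFlow.Scoring.ProductHaarLinkSets
import HarnessLib

/-!
# The exact non-abelian area law in two dimensions, VIII: local observables a column apart are EXACTLY INDEPENDENT under the free-boundary measure

HONEST FRAMING: exact (Metropolis-corrected) sampling algorithms for lattice gauge theory;
figures of merit are autocorrelation/cost numbers at stated couplings and volumes; no
continuum-physics claim.

Venture `LatticeQCDFlow` (cell pub-lqcd), sub-topic `Scoring`; FANOUT row 5 (`s0-sun-a`), GEN-22.
NEW WORK of the cell (placement rule).  Every compact second-countable gauge group `G`, every continuous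
one-plaquette weight `w` (no class property needed), product Haar measure on the links of `(ℤ/L)²`.  Parts VI/VII
(`NonabelianAreaLaw2DNestedLoops`, `…DisjointLoops`) treated two Wilson LOOPS; here two ARBITRARY continuous
local observables `Φ₁`, `Φ₂`.

* §1 **`integral_mul_prod_rect_of_forall_col`** — COLUMN-LOCAL PEELING: if `Φ` ignores the horizontal links of
  the columns `i + a`, `a < R` (nothing is asked about any other link), the `R × T₀` block of plaquette weights
  with corner `(i, j)` integrates out, `∫ Φ ∏_{p∈B} w(U_p) = (∫ w)^{R T₀} ∫ Φ` (rows peeled top-down through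
  their top links by part IV-a's strip absorption; part IV-b's `…peel_top` wants whole torus rows ignored, which
  an observable sitting BESIDE the block does not do).
* §2 bookkeeping: the links of a block's plaquettes lie in the block's columns (`fst_zero_of_mem_blockLinks`,
  `blockLinks_ne_horiz`), so blocks a column apart have disjoint link sets (`blockLinks_disjoint_of_col_gap`);
  column splitting `prod_rect_add_cols`; functions of disjoint link sets integrate multiplicatively under
  product Haar measure (`ProductHaarLinkSets.integral_mul_eq_mul_of_forall_update`).
* §3 **`integral_mul_mul_prod_weight_eq_of_col_gap`** — in the block `Reg = (c₁ + k + R₂) × T₀` with corner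
  `(i, j)` (`0 < k`), if `Φ₁` sees only the links of the plaquettes of the left sub-block `Q₁ = c₁ × T₀` and `Φ₂`
  only those of the right sub-block `Q₂ = R₂ × T₀` (corner `(i + c₁ + k, j)`), then
  `∫ Φ₁ Φ₂ ∏_{p∈Reg} w(U_p) = (∫w)^{k T₀} · (∫ Φ₁ ∏_{p∈Q₁} w(U_p)) · (∫ Φ₂ ∏_{p∈Q₂} w(U_p))`:
  under the free-boundary Yang–Mills measure of a block, TWO LOCAL OBSERVABLES SEPARATED BY ONE COLUMN OF
  PLAQUETTES ARE EXACTLY INDEPENDENT (sequel `FreeBoundaryCovariance2D`: `⟨Φ₁Φ₂⟩ = ⟨Φ₁⟩⟨Φ₂⟩`, and on the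
  torus up to a term exponentially small in the volume by part V-h; then `TorusClustering2D`: exponential
  clustering of all bounded continuous local observables at EVERY coupling in two dimensions).

No `def`, nothing cited as a fact, 0 sorry.
-/

noncomputable section

open MeasureTheory Function Finset
open Literature.MathematicalPhysics.QuantumFieldTheory
open Literature.MathematicalPhysics.QuantumLattice
open Summit.Ventures.LatticeQCDFlow.Theory2.Lattice
open Summit.Ventures.LatticeQCDFlow.Theory2.Lattice.TwoDim

namespace Summit.Ventures.LatticeQCDFlow.Scoring

variable {L : ℕ} [NeZero L] {G : Type*} [Group G] [TopologicalSpace G] [IsTopologicalGroup G]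
  [CompactSpace G] [SecondCountableTopology G] [MeasurableSpace G] [BorelSpace G]

/-! ## §1. Column-local peeling -/

/-- **COLUMN-LOCAL PEELING.**  If a continuous `Φ` ignores every horizontal link `(![i + a, y], 0)` of the
columns `a < R` (`0 < R`, `R + 1 ≤ L`), then for every `T₀ + 1 ≤ L` the `R × T₀` block of plaquette weights with
corner `(i, j)` integrates out: `∫ Φ ∏_{p∈B} w(U_p) dHaar^{⊗E} = (∫ w)^{R T₀} · ∫ Φ dHaar^{⊗E}`. -/
theorem integral_mul_prod_rect_of_forall_col {w : G → ℝ} (hw : Continuous w) (i j : ZMod L) {R : ℕ}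
    (hR0 : 0 < R) (hR : R + 1 ≤ L) {Φ : GaugeConfig 2 L G → ℂ} (hΦ : Continuous Φ)
    (hΦe : ∀ (a : ℕ) (y : ZMod L) (U : GaugeConfig 2 L G) (g : G), a < R →
      Φ (update U (![i + a, y], 0) g) = Φ U) :
    ∀ (T₀ : ℕ), T₀ + 1 ≤ L →
      ∫ U, Φ U * ∏ p ∈ (range R ×ˢ range T₀).image (fun q : ℕ × ℕ => (![i + q.1, j + q.2] : Site 2 L)),
          (w (plaquetteHolonomy U p 0 1) : ℂ) ∂(Measure.pi fun _ : Edge 2 L => haarProbability G) =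
        (∫ g, (w g : ℂ) ∂(haarProbability G)) ^ (R * T₀) *
          ∫ U, Φ U ∂(Measure.pi fun _ : Edge 2 L => haarProbability G) := by
  intro T₀
  induction T₀ with
  | zero => intro _; simp
  | succ T₀ ih =>
    intro hT₀
    haveI : Fact (1 < L) := ⟨by omega⟩
    have hRL : R ≤ L := by omega
    have hz2 : (j + T₀ : ZMod L) ≠ j + T₀ + 1 := fun h => one_ne_zero (left_eq_add.mp h)
    -- columns capped at `R - 1`, so that EVERY `e c` is a top link of the block (part IV-a quantifies all `c`)
    let col : ℕ → ℕ := fun a => min a (R - 1)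
    have hcol : ∀ a < R, col a = a := fun a ha => Nat.min_eq_left (by omega)
    have hcolR : ∀ a, col a < R := fun a => lt_of_le_of_lt (Nat.min_le_right _ _) (by omega)
    let e : ℕ → Edge 2 L := fun a => (![i + (col a : ℕ), j + T₀ + 1], 0)
    let A : ℕ → GaugeConfig 2 L G → G := fun a U => U (![i + a, j + T₀], 0) * U (![i + a + 1, j + T₀], 1)
    let B : ℕ → GaugeConfig 2 L G → G := fun a U => (U (![i + a, j + T₀], 1))⁻¹
    let Ψ : GaugeConfig 2 L G → ℂ := fun U =>
      Φ U * ∏ p ∈ (range R ×ˢ range T₀).image (fun q : ℕ × ℕ => (![i + q.1, j + q.2] : Site 2 L)),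
        (w (plaquetteHolonomy U p 0 1) : ℂ)
    have hev : ∀ e' : Edge 2 L, Continuous fun U : GaugeConfig 2 L G => U e' := fun e' => continuous_apply e'
    have he : ∀ a < R, ∀ a' < R, e a = e a' → a = a' := by
      intro a ha a' ha' h
      have h1 : (![i + (col a : ℕ), j + T₀ + 1] : Site 2 L) = ![i + (col a' : ℕ), j + T₀ + 1] :=
        congrArg Prod.fst h
      rw [hcol a ha, hcol a' ha'] at h1
      have h2 := add_left_cancel (vec2_eq_iff.mp h1).1
      by_contra hne
      exact natCast_zmod_ne_of_lt (L := L) (by omega) (by omega) hne h2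
    have hA : ∀ a, Continuous (A a) := fun a => (hev _).mul (hev _)
    have hB : ∀ a, Continuous (B a) := fun a => by
      show Continuous fun U : GaugeConfig 2 L G => (U (![i + a, j + T₀], 1))⁻¹
      exact (hev ((![i + a, j + T₀], 1) : Edge 2 L)).inv
    have hAe : ∀ a a' U g, A a (update U (e a') g) = A a U := by
      intro a a' U g
      show update U (![i + (col a' : ℕ), j + T₀ + 1], 0) g (![i + a, j + T₀], 0) *
          update U (![i + (col a' : ℕ), j + T₀ + 1], 0) g (![i + a + 1, j + T₀], 1) = _
      rw [update_of_ne (fun h => hz2 (vec2_eq_iff.mp (congrArg Prod.fst h)).2),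
        update_of_ne (fun h => absurd (congrArg Prod.snd h : (1 : Fin 2) = 0) (by decide))]
    have hBe : ∀ a a' U g, B a (update U (e a') g) = B a U := by
      intro a a' U g
      show (update U (![i + (col a' : ℕ), j + T₀ + 1], 0) g (![i + a, j + T₀], 1))⁻¹ = _
      rw [update_of_ne (fun h => absurd (congrArg Prod.snd h : (1 : Fin 2) = 0) (by decide))]
    have hΨ : Continuous Ψ :=
      hΦ.mul (continuous_finsetProd _ fun p _ =>
        Complex.continuous_ofReal.comp (hw.comp (continuous_config_plaquetteHolonomy p 0 1)))
    have hΨe : ∀ a U g, Ψ (update U (e a) g) = Ψ U := by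
      intro a U g
      show Φ (update U (![i + (col a : ℕ), j + T₀ + 1], 0) g) * _ = Φ U * _
      rw [hΦe (col a) (j + T₀ + 1) U g (hcolR a)]
      congr 1
      exact Finset.prod_congr rfl fun p hp => by
        rw [plaquetteHolonomy_update_toprow_of_mem_rect i j hT₀ hp]
    have hword : ∀ a < R, ∀ (U : GaugeConfig 2 L G),
        A a U * (U (e a))⁻¹ * B a U = plaquetteHolonomy U ![i + a, j + T₀] 0 1 := by
      intro a ha U
      simp only [A, B, e, hcol a ha, plaquetteHolonomy, shift_vec2_zero, shift_vec2_one]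
    have hpt : ∀ U : GaugeConfig 2 L G,
        Φ U * ∏ p ∈ (range R ×ˢ range (T₀ + 1)).image (fun q : ℕ × ℕ => (![i + q.1, j + q.2] : Site 2 L)),
            (w (plaquetteHolonomy U p 0 1) : ℂ) =
          (∏ a ∈ range R, (w (A a U * (U (e a))⁻¹ * B a U) : ℂ)) * Ψ U := by
      intro U
      rw [prod_rect_succ_top i j (R := R) (T := T₀) hRL (by omega)]
      have hrow : ∏ a ∈ range R, (w (plaquetteHolonomy U ![i + a, j + T₀] 0 1) : ℂ) =
          ∏ a ∈ range R, (w (A a U * (U (e a))⁻¹ * B a U) : ℂ) :=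
        Finset.prod_congr rfl fun a ha => by rw [hword a (Finset.mem_range.mp ha)]
      rw [hrow]
      simp only [Ψ]
      ring
    simp_rw [hpt]
    rw [integral_prod_invWords_mul hw R e A B Ψ he hA hB hAe hBe hΨ hΨe, ih (by omega), ← mul_assoc,
      ← pow_add]
    congr 2
    ring

/-! ## §2. Bookkeeping: the links of a block, column sub-blocks, functions of disjoint link sets -/

section Bookkeeping

omit [NeZero L] [Group G] [TopologicalSpace G] [IsTopologicalGroup G] [CompactSpace G]
  [SecondCountableTopology G] [MeasurableSpace G] [BorelSpace G] in
/-- Splitting a product over the `(R₁ + R₂) × T` block with corner `(i, j)` into the column sub-blocks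
`R₁ × T` at `(i, j)` and `R₂ × T` at `(i + R₁, j)` (`R₁ + R₂ ≤ L`, `T ≤ L`). -/
theorem prod_rect_add_cols {M' : Type*} [CommMonoid M'] (i j : ZMod L) {R₁ R₂ T : ℕ} (hR : R₁ + R₂ ≤ L)
    (hT : T ≤ L) (f : Site 2 L → M') :
    ∏ x ∈ (range (R₁ + R₂) ×ˢ range T).image (fun q : ℕ × ℕ => (![i + q.1, j + q.2] : Site 2 L)), f x =
      (∏ x ∈ (range R₁ ×ˢ range T).image (fun q : ℕ × ℕ => (![i + q.1, j + q.2] : Site 2 L)), f x) *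
        ∏ x ∈ (range R₂ ×ˢ range T).image (fun q : ℕ × ℕ => (![i + R₁ + q.1, j + q.2] : Site 2 L)), f x := by
  rw [prod_rect_eq i j hR hT, prod_rect_eq i j (by omega) hT, prod_rect_eq (i + (R₁ : ZMod L)) j (by omega) hT,
    ← Finset.prod_mul_distrib]
  refine Finset.prod_congr rfl fun b _ => ?_
  rw [Finset.prod_range_add]
  congr 1
  refine Finset.prod_congr rfl fun a _ => ?_
  rw [show (i : ZMod L) + ((R₁ + a : ℕ) : ZMod L) = i + R₁ + (a : ZMod L) by push_cast; ring]

omit [NeZero L] in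
/-- **The links of the plaquettes of a block lie in the block's columns.**  If the link `e` is one of the four
links of a plaquette of the `R × T` block with corner `(i, j)` (`R + 1 ≤ L`), then its base site has first
coordinate `i + m` for some `m ≤ R`, with `m < R` when `e` is horizontal. -/
theorem fst_zero_of_mem_blockLinks [NeZero L] (i j : ZMod L) {R T : ℕ} {e : Edge 2 L} {p : Site 2 L}
    (hp : p ∈ (range R ×ˢ range T).image (fun q : ℕ × ℕ => (![i + q.1, j + q.2] : Site 2 L)))
    (he : ((p, 0) : Edge 2 L) = e ∨ ((p.shift 0, 1) : Edge 2 L) = e ∨ ((p.shift 1, 0) : Edge 2 L) = e ∨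
      ((p, 1) : Edge 2 L) = e) :
    ∃ m : ℕ, m ≤ R ∧ e.1 0 = i + m ∧ (e.2 = 0 → m < R) := by
  obtain ⟨⟨a, b⟩, hq, rfl⟩ := Finset.mem_image.mp hp
  rw [Finset.mem_product, Finset.mem_range, Finset.mem_range] at hq
  rcases he with h | h | h | h <;> subst h
  · exact ⟨a, by omega, by simp, fun _ => hq.1⟩
  · refine ⟨a + 1, by omega, ?_, fun h => by simp at h⟩
    simp [add_assoc]
  · exact ⟨a, by omega, by simp [shift_vec2_one], fun _ => hq.1⟩
  · exact ⟨a, by omega, by simp, fun h => by simp at h⟩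

omit [NeZero L] in
/-- A horizontal link in a column OUTSIDE a block's columns is none of the links of the block's plaquettes:
block `R × T` with corner `(i', j)`, `i' = i + n₀`, link `(![i + n, y], 0)` with `n < n₀` or `n₀ + R ≤ n`. -/
theorem blockLinks_ne_horiz [NeZero L] (i i' j : ZMod L) {n₀ R T : ℕ} (hi' : i' = i + n₀) {p : Site 2 L}
    (hp : p ∈ (range R ×ˢ range T).image (fun q : ℕ × ℕ => (![i' + q.1, j + q.2] : Site 2 L)))
    {n : ℕ} (hn : n < n₀ ∨ n₀ + R ≤ n) (hnL : n < L) (hRL : n₀ + R ≤ L) (y : ZMod L) :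
    ((p, 0) : Edge 2 L) ≠ (![i + n, y], 0) ∧ ((p.shift 0, 1) : Edge 2 L) ≠ (![i + n, y], 0) ∧
      ((p.shift 1, 0) : Edge 2 L) ≠ (![i + n, y], 0) ∧ ((p, 1) : Edge 2 L) ≠ (![i + n, y], 0) := by
  have h : ¬ (((p, 0) : Edge 2 L) = (![i + n, y], 0) ∨ ((p.shift 0, 1) : Edge 2 L) = (![i + n, y], 0) ∨
      ((p.shift 1, 0) : Edge 2 L) = (![i + n, y], 0) ∨ ((p, 1) : Edge 2 L) = (![i + n, y], 0)) := by
    intro h'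
    subst hi'
    obtain ⟨m, hm, h0, hlt⟩ := fst_zero_of_mem_blockLinks (i + (n₀ : ZMod L)) j hp h'
    have hmR : m < R := hlt rfl
    have h1 : ((n : ℕ) : ZMod L) = ((n₀ + m : ℕ) : ZMod L) := by
      have h0' : (i : ZMod L) + n = i + n₀ + m := by simpa using h0
      push_cast
      linear_combination h0'
    exact natCast_zmod_ne_of_lt (L := L) hnL (by omega) (by omega) h1
  simp only [not_or] at h
  exact ⟨h.1, h.2.1, h.2.2.1, h.2.2.2⟩

omit [NeZero L] [TopologicalSpace G] [IsTopologicalGroup G] [CompactSpace G] [SecondCountableTopology G]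
  [MeasurableSpace G] [BorelSpace G] in
/-- A plaquette ignores the update of a link that is none of its four links. -/
theorem plaquetteHolonomy_update_of_ne_links {U : GaugeConfig 2 L G} {e : Edge 2 L} {p : Site 2 L} (g : G)
    (h1 : ((p, 0) : Edge 2 L) ≠ e) (h2 : ((p.shift 0, 1) : Edge 2 L) ≠ e)
    (h3 : ((p.shift 1, 0) : Edge 2 L) ≠ e) (h4 : ((p, 1) : Edge 2 L) ≠ e) :
    plaquetteHolonomy (update U e g) p 0 1 = plaquetteHolonomy U p 0 1 := by
  unfold plaquetteHolonomy
  rw [update_of_ne h1, update_of_ne h2, update_of_ne h3, update_of_ne h4]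

omit [NeZero L] in
/-- **Blocks a column apart have disjoint link sets.**  A link of a plaquette of the `c₁ × T` block with corner
`(i, j)` is not a link of a plaquette of the `R₂ × T'` block with corner `(i + c₁ + k, j')` when `0 < k` and
`c₁ + k + R₂ + 1 ≤ L`. -/
theorem blockLinks_disjoint_of_col_gap [NeZero L] (i j j' : ZMod L) {c₁ k R₂ T T' : ℕ} (hk : 0 < k)
    (hfit : c₁ + k + R₂ + 1 ≤ L) {e : Edge 2 L} {p₁ p₂ : Site 2 L}
    (hp₁ : p₁ ∈ (range c₁ ×ˢ range T).image (fun q : ℕ × ℕ => (![i + q.1, j + q.2] : Site 2 L)))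
    (hp₂ : p₂ ∈ (range R₂ ×ˢ range T').image (fun q : ℕ × ℕ => (![i + c₁ + k + q.1, j' + q.2] : Site 2 L)))
    (he₁ : ((p₁, 0) : Edge 2 L) = e ∨ ((p₁.shift 0, 1) : Edge 2 L) = e ∨ ((p₁.shift 1, 0) : Edge 2 L) = e ∨
      ((p₁, 1) : Edge 2 L) = e) :
    ¬ (((p₂, 0) : Edge 2 L) = e ∨ ((p₂.shift 0, 1) : Edge 2 L) = e ∨ ((p₂.shift 1, 0) : Edge 2 L) = e ∨
      ((p₂, 1) : Edge 2 L) = e) := by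
  intro he₂
  obtain ⟨m₁, hm₁, h₁, -⟩ := fst_zero_of_mem_blockLinks i j hp₁ he₁
  obtain ⟨m₂, hm₂, h₂, -⟩ :=
    fst_zero_of_mem_blockLinks (i + (c₁ : ZMod L) + (k : ZMod L)) j' hp₂ he₂
  have h₃ : ((m₁ : ℕ) : ZMod L) = ((c₁ + k + m₂ : ℕ) : ZMod L) := by
    have h := h₁.symm.trans h₂
    push_cast
    linear_combination h
  exact natCast_zmod_ne_of_lt (L := L) (by omega) (by omega) (by omega) h₃

end Bookkeeping

/-! ## §3. Two local observables a column apart are exactly independent -/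

section Independence

/-- **THE PRODUCT FORMULA FOR SEPARATED OBSERVABLES.**  `Reg = (c₁ + k + R₂) × T₀` at `(i, j)`
(`c₁ + k + R₂ + 1 ≤ L`, `T₀ + 1 ≤ L`, `0 < k`); `Φ₁` continuous, seeing only the links of the plaquettes of
`Q₁ = c₁ × T₀` at `(i, j)`; `Φ₂` continuous, seeing only the links of the plaquettes of `Q₂ = R₂ × T₀` at
`(i + c₁ + k, j)`; any continuous weight `w`.  Then
`∫ Φ₁ Φ₂ ∏_{p∈Reg} w(U_p) = (∫ w)^{k T₀} · (∫ Φ₁ ∏_{p∈Q₁} w(U_p)) · (∫ Φ₂ ∏_{p∈Q₂} w(U_p))`. -/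
theorem integral_mul_mul_prod_weight_eq_of_col_gap {w : G → ℝ} (hw : Continuous w) (i j : ZMod L)
    {c₁ k R₂ T₀ : ℕ} (hk : 0 < k) (hfit : c₁ + k + R₂ + 1 ≤ L) (hT : T₀ + 1 ≤ L)
    {Φ₁ Φ₂ : GaugeConfig 2 L G → ℂ} (hΦ₁ : Continuous Φ₁) (hΦ₂ : Continuous Φ₂)
    (hΦ₁e : ∀ (e : Edge 2 L) (U : GaugeConfig 2 L G) (g : G),
      (∀ p ∈ (range c₁ ×ˢ range T₀).image (fun q : ℕ × ℕ => (![i + q.1, j + q.2] : Site 2 L)),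
        ((p, 0) : Edge 2 L) ≠ e ∧ ((Site.shift p 0, 1) : Edge 2 L) ≠ e ∧
          ((Site.shift p 1, 0) : Edge 2 L) ≠ e ∧ ((p, 1) : Edge 2 L) ≠ e) → Φ₁ (update U e g) = Φ₁ U)
    (hΦ₂e : ∀ (e : Edge 2 L) (U : GaugeConfig 2 L G) (g : G),
      (∀ p ∈ (range R₂ ×ˢ range T₀).image (fun q : ℕ × ℕ => (![i + c₁ + k + q.1, j + q.2] : Site 2 L)),
        ((p, 0) : Edge 2 L) ≠ e ∧ ((Site.shift p 0, 1) : Edge 2 L) ≠ e ∧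
          ((Site.shift p 1, 0) : Edge 2 L) ≠ e ∧ ((p, 1) : Edge 2 L) ≠ e) → Φ₂ (update U e g) = Φ₂ U) :
    ∫ U, Φ₁ U * Φ₂ U *
        ∏ p ∈ (range (c₁ + k + R₂) ×ˢ range T₀).image (fun q : ℕ × ℕ => (![i + q.1, j + q.2] : Site 2 L)),
          (w (plaquetteHolonomy U p 0 1) : ℂ) ∂(Measure.pi fun _ : Edge 2 L => haarProbability G) =
      (∫ g, (w g : ℂ) ∂(haarProbability G)) ^ (k * T₀) *
        ((∫ U, Φ₁ U * ∏ p ∈ (range c₁ ×ˢ range T₀).image (fun q : ℕ × ℕ => (![i + q.1, j + q.2] : Site 2 L)),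
            (w (plaquetteHolonomy U p 0 1) : ℂ) ∂(Measure.pi fun _ : Edge 2 L => haarProbability G)) *
          ∫ U, Φ₂ U * ∏ p ∈ (range R₂ ×ˢ range T₀).image
              (fun q : ℕ × ℕ => (![i + c₁ + k + q.1, j + q.2] : Site 2 L)),
            (w (plaquetteHolonomy U p 0 1) : ℂ) ∂(Measure.pi fun _ : Edge 2 L => haarProbability G)) := by
  classical
  haveI : Fact (1 < L) := ⟨by omega⟩
  set Q₁ := (range c₁ ×ˢ range T₀).image (fun q : ℕ × ℕ => (![i + q.1, j + q.2] : Site 2 L)) with hQ₁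
  set QM := (range k ×ˢ range T₀).image (fun q : ℕ × ℕ => (![i + c₁ + q.1, j + q.2] : Site 2 L)) with hQM
  set Q₂ := (range R₂ ×ˢ range T₀).image (fun q : ℕ × ℕ => (![i + c₁ + k + q.1, j + q.2] : Site 2 L))
    with hQ₂
  -- the block's product, split into the three column sub-blocks
  have hsplit : ∀ U : GaugeConfig 2 L G,
      ∏ p ∈ (range (c₁ + k + R₂) ×ˢ range T₀).image (fun q : ℕ × ℕ => (![i + q.1, j + q.2] : Site 2 L)),
          (w (plaquetteHolonomy U p 0 1) : ℂ) =
        (∏ p ∈ Q₁, (w (plaquetteHolonomy U p 0 1) : ℂ)) * ((∏ p ∈ QM, (w (plaquetteHolonomy U p 0 1) : ℂ)) *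
          ∏ p ∈ Q₂, (w (plaquetteHolonomy U p 0 1) : ℂ)) := by
    intro U
    rw [show c₁ + k + R₂ = c₁ + (k + R₂) by ring,
      prod_rect_add_cols i j (R₁ := c₁) (R₂ := k + R₂) (by omega) (by omega),
      prod_rect_add_cols (i + (c₁ : ZMod L)) j (R₁ := k) (R₂ := R₂) (by omega) (by omega)]
  -- the observable riding along while the middle block is peeled
  set Ψ : GaugeConfig 2 L G → ℂ := fun U =>
    (Φ₁ U * ∏ p ∈ Q₁, (w (plaquetteHolonomy U p 0 1) : ℂ)) *
      (Φ₂ U * ∏ p ∈ Q₂, (w (plaquetteHolonomy U p 0 1) : ℂ)) with hΨ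
  have hpt : ∀ U : GaugeConfig 2 L G,
      Φ₁ U * Φ₂ U * ∏ p ∈ (range (c₁ + k + R₂) ×ˢ range T₀).image
          (fun q : ℕ × ℕ => (![i + q.1, j + q.2] : Site 2 L)), (w (plaquetteHolonomy U p 0 1) : ℂ) =
        Ψ U * ∏ p ∈ QM, (w (plaquetteHolonomy U p 0 1) : ℂ) := by
    intro U; rw [hsplit U]; simp only [Ψ]; ring
  have hprodc : ∀ s : Finset (Site 2 L), Continuous fun U : GaugeConfig 2 L G =>
      ∏ p ∈ s, (w (plaquetteHolonomy U p 0 1) : ℂ) := fun s =>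
    continuous_finsetProd _ fun p _ =>
      Complex.continuous_ofReal.comp (hw.comp (continuous_config_plaquetteHolonomy p 0 1))
  have hΨc : Continuous Ψ := (hΦ₁.mul (hprodc Q₁)).mul (hΦ₂.mul (hprodc Q₂))
  -- `Ψ` ignores the horizontal links of the middle columns `i + c₁ + a`, `a < k`
  have hΨe : ∀ (a : ℕ) (y : ZMod L) (U : GaugeConfig 2 L G) (g : G), a < k →
      Ψ (update U (![i + c₁ + a, y], 0) g) = Ψ U := by
    intro a y U g ha
    have hcast : (![i + c₁ + a, y] : Site 2 L) = ![i + ((c₁ + a : ℕ) : ZMod L), y] := by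
      push_cast; rw [add_assoc]
    have h₁ : ∀ p ∈ Q₁, ((p, 0) : Edge 2 L) ≠ (![i + c₁ + a, y], 0) ∧
        ((Site.shift p 0, 1) : Edge 2 L) ≠ (![i + c₁ + a, y], 0) ∧
        ((Site.shift p 1, 0) : Edge 2 L) ≠ (![i + c₁ + a, y], 0) ∧
        ((p, 1) : Edge 2 L) ≠ (![i + c₁ + a, y], 0) := by
      intro p hp
      rw [hcast]
      exact blockLinks_ne_horiz i i j (n₀ := 0) (by simp) hp (Or.inr (by omega)) (by omega) (by omega) y
    have h₂ : ∀ p ∈ Q₂, ((p, 0) : Edge 2 L) ≠ (![i + c₁ + a, y], 0) ∧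
        ((Site.shift p 0, 1) : Edge 2 L) ≠ (![i + c₁ + a, y], 0) ∧
        ((Site.shift p 1, 0) : Edge 2 L) ≠ (![i + c₁ + a, y], 0) ∧
        ((p, 1) : Edge 2 L) ≠ (![i + c₁ + a, y], 0) := by
      intro p hp
      rw [hcast]
      exact blockLinks_ne_horiz i (i + (c₁ : ZMod L) + (k : ZMod L)) j (n₀ := c₁ + k) (by push_cast; ring) hp
        (Or.inl (by omega)) (by omega) (by omega) y
    have hP₁ : ∏ p ∈ Q₁, (w (plaquetteHolonomy (update U (![i + c₁ + a, y], 0) g) p 0 1) : ℂ) =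
        ∏ p ∈ Q₁, (w (plaquetteHolonomy U p 0 1) : ℂ) :=
      Finset.prod_congr rfl fun p hp => by
        obtain ⟨e1, e2, e3, e4⟩ := h₁ p hp
        rw [plaquetteHolonomy_update_of_ne_links g e1 e2 e3 e4]
    have hP₂ : ∏ p ∈ Q₂, (w (plaquetteHolonomy (update U (![i + c₁ + a, y], 0) g) p 0 1) : ℂ) =
        ∏ p ∈ Q₂, (w (plaquetteHolonomy U p 0 1) : ℂ) :=
      Finset.prod_congr rfl fun p hp => by
        obtain ⟨e1, e2, e3, e4⟩ := h₂ p hp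
        rw [plaquetteHolonomy_update_of_ne_links g e1 e2 e3 e4]
    simp only [Ψ]
    rw [hΦ₁e _ U g h₁, hΦ₂e _ U g h₂, hP₁, hP₂]
  -- peel the middle block
  simp_rw [hpt]
  rw [integral_mul_prod_rect_of_forall_col hw (i + (c₁ : ZMod L)) j hk (by omega) hΨc hΨe T₀ hT]
  congr 1
  -- factorise: `Φ₁ ∏_{Q₁} w` lives on the links of the plaquettes of `Q₁`, `Φ₂ ∏_{Q₂} w` off them
  let D : Finset (Edge 2 L) := Q₁.biUnion fun p =>
    {((p, 0) : Edge 2 L), ((Site.shift p 0, 1) : Edge 2 L), ((Site.shift p 1, 0) : Edge 2 L),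
      ((p, 1) : Edge 2 L)}
  have hD : ∀ e : Edge 2 L, e ∉ D → ∀ p ∈ Q₁, ((p, 0) : Edge 2 L) ≠ e ∧
      ((Site.shift p 0, 1) : Edge 2 L) ≠ e ∧ ((Site.shift p 1, 0) : Edge 2 L) ≠ e ∧
      ((p, 1) : Edge 2 L) ≠ e := by
    intro e he p hp
    simp only [D, Finset.mem_biUnion, Finset.mem_insert, Finset.mem_singleton, not_exists, not_and,
      not_or] at he
    obtain ⟨e1, e2, e3, e4⟩ := he p hp
    exact ⟨Ne.symm e1, Ne.symm e2, Ne.symm e3, Ne.symm e4⟩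
  have hD' : ∀ e : Edge 2 L, e ∈ D → ∀ p ∈ Q₂, ((p, 0) : Edge 2 L) ≠ e ∧
      ((Site.shift p 0, 1) : Edge 2 L) ≠ e ∧ ((Site.shift p 1, 0) : Edge 2 L) ≠ e ∧
      ((p, 1) : Edge 2 L) ≠ e := by
    intro e he p₂ hp₂
    simp only [D, Finset.mem_biUnion, Finset.mem_insert, Finset.mem_singleton] at he
    obtain ⟨p₁, hp₁, he₁⟩ := he
    have he₁' : ((p₁, 0) : Edge 2 L) = e ∨ ((Site.shift p₁ 0, 1) : Edge 2 L) = e ∨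
        ((Site.shift p₁ 1, 0) : Edge 2 L) = e ∨ ((p₁, 1) : Edge 2 L) = e := by
      rcases he₁ with h | h | h | h
      · exact Or.inl h.symm
      · exact Or.inr (Or.inl h.symm)
      · exact Or.inr (Or.inr (Or.inl h.symm))
      · exact Or.inr (Or.inr (Or.inr h.symm))
    have h := blockLinks_disjoint_of_col_gap i j j hk hfit hp₁ hp₂ he₁'
    simp only [not_or] at h
    exact ⟨h.1, h.2.1, h.2.2.1, h.2.2.2⟩
  refine integral_mul_eq_mul_of_forall_update (haarProbability G) D _ _ (fun e he U g => ?_)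
    (fun e he U g => ?_)
  · have h := hD e he
    show Φ₁ (update U e g) * ∏ p ∈ Q₁, (w (plaquetteHolonomy (update U e g) p 0 1) : ℂ) =
      Φ₁ U * ∏ p ∈ Q₁, (w (plaquetteHolonomy U p 0 1) : ℂ)
    rw [hΦ₁e e U g h]
    congr 1
    exact Finset.prod_congr rfl fun p hp => by
      obtain ⟨e1, e2, e3, e4⟩ := h p hp
      rw [plaquetteHolonomy_update_of_ne_links g e1 e2 e3 e4]
  · have h := hD' e he
    show Φ₂ (update U e g) * ∏ p ∈ Q₂, (w (plaquetteHolonomy (update U e g) p 0 1) : ℂ) =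
      Φ₂ U * ∏ p ∈ Q₂, (w (plaquetteHolonomy U p 0 1) : ℂ)
    rw [hΦ₂e e U g h]
    congr 1
    exact Finset.prod_congr rfl fun p hp => by
      obtain ⟨e1, e2, e3, e4⟩ := h p hp
      rw [plaquetteHolonomy_update_of_ne_links g e1 e2 e3 e4]

end Independence


end Summit.Ventures.LatticeQCDFlow.Scoring
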